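import Summits.CriticalPhenomena.PercolationContinuityZ3.Theorems.Transplant.FKConnectivityAllQForestRayleighK4
import HarnessLib

/-!
# The CONNECTED twin (♠)⁰ of the square-free adjacent forest Rayleigh node: coefficientwise adjacent-pair Rayleigh for CONNECTED SPANNING
# subgraphs (the uniform-connected-subgraph corner `q → 0`, `p` fixed, of the random-cluster model) — node `AdjConnRayleighNoSqOn/Pos`
# (NOT asserted), the all-pairs form `ConnRayleighNoSqOn`, and the kernel certificate that adjacency is essential (`K₄`, opposite pair)

Support file (`--supports stmt-CriticalPhenomena-4575`), FK sub-lane `prim-bschramm-fk-1` (gen 19) of the post-continuity programme;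
builds on p205010 (kernel theorem, internal audit signed; external expert review pending).  Two counting predicates and one `@[conjecture]`
node (definitions, NOT asserted), no named facts, no sorries; standard axioms (`decide +kernel` on `2⁶` configurations, instant).

THE STATEMENT.  For a finite graph `G'` and two ADJACENT edges `e = ov`, `f = oy`, among the ordered partitions `(A', B')` of `E(G')` into
two CONNECTED SPANNING subgraphs, `#{e, f ∈ A'} ≤ #{e ∈ A', f ∈ B'}`; in fibre form (all minors at once, as for the forest node
`AdjForestRayleighNoSqOn` of `…TwoClusterRayleighNoSq.lean`): for every fibre `(M, u₀)`,
`#(ω ∈ L₁ ∋ e, f ; ω ∆ M ∈ L₁) ≤ #(ω ∈ L₁ ∋ e ; ω ∆ M ∈ L₁ ∋ f)`, `L₁ = levelSet V 1` = exactly one open cluster = connected spanning.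
This is the square-free, coefficientwise, adjacent-pair form of the uniform-connected-subgraph (UCS) half of Grimmett's Conjecture (3.96)
(edge-negative association of USF and UCS; Grimmett–Winkler; Semple–Welsh Conj. 1.2), exactly as `AdjForestRayleighNoSqOn` is for the
USF/arboreal-gas half.
WHY (fk-1 g19, memo bschramm/FROM-fk-1-g19-ADVERSARIAL.md §5b).  For a plane graph `G`, `A' ⊆ E` is a forest iff the dual complement
`(E ∖ A')^*` is connected and spanning in `G^*` (Grimmett 2006, remark after Thm (3.100)); so forest 2-colourings of `G` are connected
2-colourings of `G^*`, and `e, f` adjacent in `G` iff `e^*, f^*` are cofacial in `G^*`.  Hence (♣)⁰ = `AdjForestRayleighNoSqOn` on planar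
graphs at adjacent pairs is (♠)⁰ on the duals at COFACIAL pairs and vice versa, and fk-1 g18's K₄-OPPOSITE CONJECTURE (coefficientwise
forest pair-Rayleigh ⟺ no rooted `K₄` minor with `e, f` opposite), restricted to planar graphs, contains the adjacent-pair statements for
BOTH models.  EVIDENCE (gen 19, exact enumeration, engines numerics/ucstat.c + spadeadv.c): 0 failures on every graph with ≤ 7 vertices
(n = 7: all 374 graphs with `m ≥ 2n − 2`, 13,410 instances `(G'; o, {v,y})`, 1,896 tight) and on every 8-vertex graph with ≤ 17 edges
(5,495 graphs, 205,726 instances); adversarial annealing at n = 9 found none.  ADJACENCY IS ESSENTIAL: on `K₄` (self-dual) at the opposite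
pair `e = 01`, `f = 23` the all-pairs form fails with the same counts as the forest form, `bad = 4 > 2 = good` (the twelve Hamiltonian paths
of `K₄` are the connected spanning subgraphs with connected spanning complement) — **`not_connRayleighNoSqOn_fin_four`**, by gen 17's fast
evaluator (`kOf` = cluster count, `fibreCount_conf_eq_card_bool`, `three_counts_eq_sumR`, one `decide +kernel`), reusing `k4D` and the mask
lemmas of `…ForestRayleighK4.lean`.
[cite: Grimmett2006, §3.9 Conj. (3.96) (p. 65); §3.9 after Thm. (3.100) (p. 66); §1.5 (p. 13)] [cite: SempleWelsh2008, Conj. 1.2 (p. 2); Thm. 4.2 (p. 11)]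
[cite: Linusson2011, Prop. 2.6]
-/

namespace Summit.CriticalPhenomena.PercolationContinuityZ3.Theorems

namespace FK

open Set Literature.Probability.LatticeModels Literature.Probability.Percolation
open scoped Classical symmDiff

/-! ### The nodes (NOT asserted) -/

/-- **Square-free coefficientwise CONNECTED-subgraph Rayleigh at an adjacent pair on the vertex type `V`** (`e = ov ≠ f = oy`): for every
fibre, `#(L₁ ∩ J_e ∩ J_f, L₁) ≤ #(L₁ ∩ J_e, L₁ ∩ J_f)`, `L₁` = connected spanning configurations.  The planar dual of `AdjForestRayleighNoSqOn`
(adjacent ↔ cofacial). [cite: Grimmett2006, §3.9 Conj. (3.96) (p. 65)] [cite: SempleWelsh2008, Conj. 1.2 (p. 2)] [cite: Linusson2011, Prop. 2.6] -/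
def AdjConnRayleighNoSqOn (V : Type*) [Fintype V] : Prop :=
  ∀ (M u₀ : BondConfig V), Disjoint u₀ M → ∀ (o v y : V), v ≠ y →
    fibreCount M u₀ (levelSet V 1 ∩ {ω | s(o, v) ∈ ω ∧ s(o, y) ∈ ω}) (levelSet V 1) ≤
      fibreCount M u₀ (levelSet V 1 ∩ {ω | s(o, v) ∈ ω}) (levelSet V 1 ∩ {ω | s(o, y) ∈ ω})

/-- **(♠)⁰ on every finite vertex type.**  CONJECTURE-SHAPED COUNTING STATEMENT, NOT asserted.  Evidence (fk-1 g19, exact): 0 failures on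
all graphs with ≤ 7 vertices (13,410 instances at n = 7) and all 8-vertex graphs with ≤ 17 edges (205,726 instances); false for non-adjacent
pairs (`not_connRayleighNoSqOn_fin_four`). [cite: Grimmett2006, §3.9 Conj. (3.96) (p. 65)] [cite: SempleWelsh2008, Conj. 1.2 (p. 2)] -/
@[conjecture] def AdjConnRayleighNoSqPos : Prop := ∀ n : ℕ, AdjConnRayleighNoSqOn (Fin n)

/-- **All-pairs square-free connected-subgraph Rayleigh on `V`** (every two pairs `e ≠ f`).  FALSE on `K₄` (`not_connRayleighNoSqOn_fin_four`).
[cite: SempleWelsh2008, Conj. 1.2 (p. 2); Thm. 4.2 (p. 11)] [cite: Linusson2011, Prop. 2.6] -/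
def ConnRayleighNoSqOn (V : Type*) [Fintype V] : Prop :=
  ∀ (M u₀ : BondConfig V), Disjoint u₀ M → ∀ (e f : Sym2 V), e ≠ f →
    fibreCount M u₀ (levelSet V 1 ∩ {ω | e ∈ ω ∧ f ∈ ω}) (levelSet V 1) ≤
      fibreCount M u₀ (levelSet V 1 ∩ {ω | e ∈ ω}) (levelSet V 1 ∩ {ω | f ∈ ω})

/-- **All pairs ⇒ adjacent pairs.** [cite: SempleWelsh2008, Conj. 1.2 (p. 2)] -/
theorem adjConnRayleighNoSqOn_of_connRayleighNoSqOn {V : Type*} [Fintype V] (h : ConnRayleighNoSqOn V) :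
    AdjConnRayleighNoSqOn V :=
  fun M u₀ hd o v y hvy => h M u₀ hd s(o, v) s(o, y) fun h' => hvy (Sym2.congr_right.1 h')

/-! ### `K₄` with the opposite pair `e = 01`, `f = 23`: connected version -/

namespace ConnectedRayleighK4

open RCEval ForestRayleighK4

/-- Indicator of the `bad` pairs: `e, f ∈ ω`, `ω` and `M ∖ ω` connected spanning. [cite: SempleWelsh2008, Thm. 4.2 (p. 11)] -/
def cbad (a : ℕ) : Bool := a.testBit 0 && (a.testBit 1 && ((k4D.kOf a == 1) && (k4D.kOf (cpl a) == 1)))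

/-- Indicator of the `good` pairs: `e ∈ ω`, `f ∈ M ∖ ω`, both connected spanning. [cite: SempleWelsh2008, Thm. 4.2 (p. 11)] -/
def cgood (a : ℕ) : Bool := a.testBit 0 && ((k4D.kOf a == 1) && ((cpl a).testBit 1 && (k4D.kOf (cpl a) == 1)))

/-- **The count**: `bad + 0 + (64 − good) = 66` (`bad = 4`, `good = 2`). (this file's `decide +kernel` evaluation) -/
theorem sumR_eq_66 : sumR (fun a => cond (cbad a) 1 0 + cond false 1 0 + cond (cgood a) 0 1) 6 0 = 66 := by decide +kernel

/-- `kOf = 1` reads membership in `levelSet (Fin 4) 1`. [cite: Grimmett2006, §1.2 eq. (1.1) (p. 4)] -/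
theorem level_iff (a : ℕ) : k4D.conf (k4D.tOf a) ∈ levelSet (Fin 4) 1 ↔ (k4D.kOf a == 1) = true := by
  rw [mem_levelSet_iff, ← kOf_eq_clusterCount (D := k4D) a, beq_iff_eq]

/-- The `bad` predicate is `cbad`. [cite: SempleWelsh2008, Thm. 4.2 (p. 11)] -/
theorem bad_iff (a : ℕ) (_ha : a < 2 ^ 6) :
    (k4D.conf (k4D.tOf a) ∈ levelSet (Fin 4) 1 ∩ {ω | s((0 : Fin 4), 1) ∈ ω ∧ s((2 : Fin 4), 3) ∈ ω} ∧
        k4D.conf (k4D.tOf (Nat.xor (2 ^ 6 - 1) a)) ∈ levelSet (Fin 4) 1) ↔ cbad a = true := by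
  rw [cpl_eq]
  simp only [Set.mem_inter_iff, Set.mem_setOf_eq, (mem_iff a).1, (mem_iff a).2]
  rw [level_iff a, level_iff (cpl a)]
  simp only [cbad, Bool.and_eq_true]
  tauto

/-- The `good` predicate is `cgood`. [cite: SempleWelsh2008, Thm. 4.2 (p. 11)] -/
theorem good_iff (a : ℕ) (_ha : a < 2 ^ 6) :
    (k4D.conf (k4D.tOf a) ∈ levelSet (Fin 4) 1 ∩ {ω | s((0 : Fin 4), 1) ∈ ω} ∧
        k4D.conf (k4D.tOf (Nat.xor (2 ^ 6 - 1) a)) ∈ levelSet (Fin 4) 1 ∩ {ω | s((2 : Fin 4), 3) ∈ ω}) ↔ cgood a = true := by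
  rw [cpl_eq]
  simp only [Set.mem_inter_iff, Set.mem_setOf_eq, (mem_iff a).1, (mem_iff (cpl a)).2]
  rw [level_iff a, level_iff (cpl a)]
  simp only [cgood, Bool.and_eq_true]
  tauto

/-- **`¬ ConnRayleighNoSqOn (Fin 4)`**: on `K₄` at the opposite pair `e = 01`, `f = 23` (fibre = all six edges, `u₀ = ∅`) the connected form
fails with `bad = 4 > 2 = good` (complementary Hamiltonian-path pairs), exactly as the forest form does (self-duality of `K₄`): the adjacency
hypothesis of `AdjConnRayleighNoSqOn` cannot be dropped. [cite: SempleWelsh2008, Thm. 4.2 (p. 11)] [cite: Grimmett2006, §3.9 after Thm. (3.100) (p. 66)] -/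
theorem not_connRayleighNoSqOn_fin_four : ¬ ConnRayleighNoSqOn (Fin 4) := by
  intro h
  have h6 : (6 : ℕ) ≤ k4D.m := by decide
  have h01 : s((0 : Fin 4), 1) ≠ s((2 : Fin 4), 3) := by decide
  have key := h (k4D.conf (k4D.firstT 6)) ∅ disjoint_bot_left _ _ h01
  have hzero : fibreCount (k4D.conf (k4D.firstT 6)) ∅ (∅ : Set (BondConfig (Fin 4))) ∅ = 0 :=
    fibreCount_eq_zero_of_left _ _ rfl _
  rw [fibreCount_conf_eq_card_bool valid h6 cbad bad_iff, fibreCount_conf_eq_card_bool valid h6 cgood good_iff] at key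
  rw [fibreCount_conf_eq_card_bool valid h6 (fun _ => false) false_iff] at hzero
  obtain ⟨h3, hle⟩ := three_counts_eq_sumR 6 cbad (fun _ => false) cgood
  rw [sumR_eq_66, hzero] at h3
  generalize ((Finset.range (2 ^ 6)).filter fun a => cbad a = true).card = c₁ at h3 key
  generalize ((Finset.range (2 ^ 6)).filter fun a => cgood a = true).card = c₃ at h3 hle key
  have h64 : (2 : ℕ) ^ 6 = 64 := by norm_num
  rw [h64] at h3 hle
  omega

/-- **`¬ (∀ n, ConnRayleighNoSqOn (Fin n))`.** [cite: SempleWelsh2008, Thm. 4.2 (p. 11)] -/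
theorem not_connRayleighNoSqOn_all : ¬ (∀ n : ℕ, ConnRayleighNoSqOn (Fin n)) := fun h => not_connRayleighNoSqOn_fin_four (h 4)

end ConnectedRayleighK4

end FK

end Summit.CriticalPhenomena.PercolationContinuityZ3.Theorems
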